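import Summits.ResolutionOfSingularities.ResolutionOfSingularities.Theses.FrobeniusLadder
import Summits.ResolutionOfSingularities.ResolutionOfSingularities.Theorems.FrobeniusLadderFInjectiveMacaulayficationStepDoorStacksFree
import HarnessLib

/-!
# Crux `FInjectiveMacaulayfication` (stmt-ResolutionOfSingularities-15315) — SKELETON v41.1 «FULL-TO-REGULAR DOOR» («STEP DOOR») ON TWO PRINTS
# (v41 text; `stub_namedFacts` shrunk to TWO printed theorems per res-L1-w45a-plan-1 R21.8 (4): F-77 admitted by name ✓p652257, F-76 Raynaud–Gruson re-plumbed ✓p652769/✓p652915)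
# (res-L1-w45a-plan-1 RULING R18.16 (3) «v41 GO» after res-L1-w45a-tri-2's V-READ PASS of `TrFullStepDoor` ((k1)(k2)(k3) met); text prepared by res-L1-w45a-stub-3 g9 over
# `TrFullStep` p618253 / `TrFullStepDoor` p618670; companion twins `Lines/step_door_twins.lean`, dossier `Lines/step-door.md`; registrar res-L1-w45a-lead-1)

[OURS · L1 W4.5a] Skeleton file (`ledger skeleton check … --crux stmt-ResolutionOfSingularities-15315`); ZERO-binder theorems only; sorries ONLY in the three `stub_*`;
the deciding theorem `FInjectiveMacaulayfication_of` (alias `FInjectiveMacaulayfication_proof`) concludes the route decl BY NAME. AI-written (AI review is weaker than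
expert review).

THE LINE. The crux's two research stubs in ONE currency — Frobenius behaviour of local rings — and ONE shape — fibre-local steps at closed singular points of local
dimension ≥ 4 on admissible local blow-ups regular off the closed fibre, each concluding with a fibre-supported centre:
  * the «CM ⇒ FULL» step (F-half) `LocalFInjectivizationFibreAdmGe4`: Cohen–Macaulay input ↦ a centre all of whose blowings up are FULL (F-injective CM, locally integral);
  * the «FULL ⇒ REGULAR» step (T-half, v41) `TrFullStep.LocalRegularizationFibreFullTr p e 1`, e ≥ 4: at a closed singular point with FULL local ring of an integral
    separated finite-type e-fold over k(s) (ONE transcendental, k any field of char p), a FULL admissible modification regular off the closed fibre ↦ a centre all of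
    whose blowings up are REGULAR.
Assembly `TrFullStepDoor.fInjectiveMacaulayfication_of_prints_of_LFadmF_of_tStepOne`: Temkin's Noetherian induction run on FULL varieties (one pass per variety: CM-ify
by Česnavičius-(B) → FULL-ify by the F-half → regularize by the step, at each of the finitely many bad closed points; Cossart–Piltant and the lower levels off the
closed points), strong induction on the level, then the F-ladder split (p613542) and v38's assembly (`OfTrRungs…`).
CALIBRATION CHAIN BY DECL NAME (all modulo the prints; the converses also modulo Česnavičius (B) ∧ the F-half): v38 T(p,e,1) ⇒ v40 T_FULL(p,e,1) (`TrFull.trFull_of_tr`)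
⇒ v41 T″(p,e,1) (`TrFullStep.tStep_of_trFull`); back: T″ ⇒ ResolutionFullTr (`TrFullStepDoor.resolutionFullTr_le_of_prints_of_F_of_tStep`) ⇒ T
(`TrOfResolutionFull.tr_le_of_cesnaviciusOffClosed_of_F_of_resolutionFull`); T ⟺ ResolutionTr (`ResolutionOfTr.resolutionTr_iff_tr`). v41's letter is the
KERNEL-WEAKEST (R18.7 criterion). PER DIMENSION: dim ≤ 4 ⟸ prints ∧ F(4) (unchanged); dim ≤ 5 ⟸ prints ∧ F(4) ∧ F(5) ∧ T″(p,4,1)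
(`TrFullStepDoor.fInjectiveMacaulayfication_dimLe5_of_cesnaviciusOffClosed_of_tStep41_of_F45`).
HONEST CAVEATS: weaker in LETTER only — equivalent to v38/v39-FL/v40 modulo prints ∧ F-half; open for every e ≥ 4; FULL ⊋ F-rational (not rung `FRationalResolution`
stmt-…-15317); the step's conclusion asks only a FIBRE-supported centre (the Sing-supported global centre comes from Temkin's extension: every bad closed point is
singular). v38 `Lines/Sketch.lean`, v39-FL `Lines/full_ladder.lean`, v40 `Lines/local_full.lean` stay as lines of record by evidence. KILL TEST: none of the three stubs is
known false; K4.5 ALIVE.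
-/

-- single-problem summit: the doubled namespace component is forced
set_option linter.dupNamespace false

noncomputable section

namespace Summit.ResolutionOfSingularities.ResolutionOfSingularities.Cruxes.FInjectiveMacaulayfication.StepDoor

open AlgebraicGeometry CategoryTheory Literature.AlgebraicGeometry.Resolution

/-- NAMED FACTS BY NAME (the ONE named-fact stub, NEVER a prover target): TWO printed theorems — Cossart–Piltant 2019 Thm 1.1 (`CossartPiltant2019General`) and Česnavičius 2021
Thm 5.3 reading (B) (`CesnaviciusBlowupMacaulayficationOffClosed`, Literature p602953). Of v38–v41's four conjuncts, Cossart–Piltant 2019 Prop 4.4 is now the TREE THEOREM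
`CP2008Prop44.CossartPiltant2019Principalization_holds` (F-77) and Raynaud–Gruson flattening (`Stacks081R`, F-76) was a PHANTOM hypothesis, re-plumbed onto the unconditional
`Morphisms.exists_isBlowup_dominating` by the `StacksFree` twins (✓ p652769, ✓ p652915). [cite: CossartPiltant2019, Thm. 1.1] [cite: Cesnavicius2021, Thm. 5.3] -/
theorem stub_namedFacts :
    Literature.AlgebraicGeometry.Resolution.CossartPiltant2019General.{0} ∧
      Literature.AlgebraicGeometry.Resolution.CesnaviciusBlowupMacaulayficationOffClosed.{0} := by
  sorry

/-- STUB (T″) — **THE «FULL ⇒ REGULAR» FIBRE-LOCAL STEP AT FULL GERMS OF `e`-FOLDS OVER `k(s)`, `e ≥ 4`** (`TrFullStep.LocalRegularizationFibreFullTr p e 1` BY NAME,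
res-L1-w45a-stub-3 g9 p618253): for every prime `p`, every `e ≥ 4`, every field `k` of characteristic `p`, every INTEGRAL separated finite-type scheme `Y` over
`K := FractionRing (MvPolynomial (Fin 1) k)` with `dim Y = e`, every CLOSED point `y ∉ Reg Y` whose local ring is FULL (`SliceableCentre.FullCl p`), and every blowing up
`S′ → Spec 𝒪_{Y,y}` along an ADMISSIBLE centre `I ≠ ⊥` (`supp I ⊆ (Reg Spec 𝒪_{Y,y})ᶜ`) which is regular off the closed fibre and FULL AT EVERY STALK: there is `𝓚 ≠ ⊥` on `S′`,
supported in the closed fibre, ALL of whose blowings up are REGULAR. The mirror image of the F-half (CMCl ↦ FullCl on `S′`; FULL ↦ regular in the conclusion). IMPLIED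
by v40's stub (`TrFullStep.tStep_of_trFull`) hence by v38's; implies both back given the prints, Česnavičius (B) and the F-half (twins file). Vacuous on 4-folds; on 5-folds
exactly T″(p,4,1). Open for every `e ≥ 4`. [conjecture · OURS · v41 stub] -/
theorem stub_localRegularizationFibreFullTr :
    ∀ p e : ℕ, p.Prime → 4 ≤ e →
      Summit.ResolutionOfSingularities.ResolutionOfSingularities.Theorems.FInjectiveMacaulayfication.TrFullStep.LocalRegularizationFibreFullTr p e 1 := by
  sorry

/-- STUB (F_adm) — **THE «CM ⇒ FULL» FIBRE-LOCAL STEP** (`LocalFullificationFibreAdmGe4Split.LocalFInjectivizationFibreAdmGe4` BY NAME, res-L1-w45a-stub-2 p591179; byte-identical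
to v37/v38/v39-FL/v40): at a CLOSED point `x ∉ Reg X` with `dim 𝒪_{X,x} = d ≥ 4` (`X` integral separated f.t./k, char p), a blowing up `S′` of `Spec 𝒪_{X,x}` along `I ≠ ⊥`
with `supp I ⊆ (Reg Spec 𝒪_{X,x})ᶜ`, regular off its closed fibre and Cohen–Macaulay at EVERY point, admits `𝓚 ≠ ⊥` supported in the closed fibre all of whose blowing
ups are FULL at every point. Kernel census: three informative F(4)-iso rows at p = 2, F4POS-1 complete for the τ-floor of P2d4C, F4POS-2 plumbing p618085 (row modulo
the τ·K certificate); negative F-centre row `¬ LFBAdm 2 1 4` p615778. No counterexample known. [conjecture · OURS · v41 stub] -/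
theorem stub_localFInjectivizationFibreAdmGe4 :
    Summit.ResolutionOfSingularities.ResolutionOfSingularities.Theorems.FInjectiveMacaulayfication.LocalFullificationFibreAdmGe4Split.LocalFInjectivizationFibreAdmGe4 := by
  sorry

/-- **THE DECIDING THEOREM (v41.1, full-to-regular door on two prints)**: the crux `FInjectiveMacaulayfication` BY NAME from the TWO prints, the «CM ⇒ FULL» step (F_adm) and the
«FULL ⇒ REGULAR» step (T″ at `r = 1`), by `StacksFree.fInjectiveMacaulayfication_of_twoPrints_of_LFadmF_of_tStepOne` (res-L1-w45a-lead-1 g10 ✓ p652915, the flattening-free twin of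
res-L1-w45a-stub-3's `TrFullStepDoor.fInjectiveMacaulayfication_of_prints_of_LFadmF_of_tStepOne` p618670 with F-77 supplied by the tree). [OURS assembly; v41.1] -/
theorem FInjectiveMacaulayfication_of :
    Summit.ResolutionOfSingularities.ResolutionOfSingularities.Theses.FrobeniusLadder.FInjectiveMacaulayfication :=
  Summit.ResolutionOfSingularities.ResolutionOfSingularities.Theorems.FInjectiveMacaulayfication.StacksFree.fInjectiveMacaulayfication_of_twoPrints_of_LFadmF_of_tStepOne
    stub_namedFacts.1 stub_namedFacts.2 stub_localFInjectivizationFibreAdmGe4 stub_localRegularizationFibreFullTr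

/-- The same deciding term under v38's name convention. [OURS assembly; v41] -/
theorem FInjectiveMacaulayfication_proof :
    Summit.ResolutionOfSingularities.ResolutionOfSingularities.Theses.FrobeniusLadder.FInjectiveMacaulayfication :=
  FInjectiveMacaulayfication_of

end Summit.ResolutionOfSingularities.ResolutionOfSingularities.Cruxes.FInjectiveMacaulayfication.StepDoor

end
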